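/-
Copyright: the b2b-balaban T⁴-continuum CRUX team, row NE7b leaf lineage `t4-ne7b-formalise-leaf-03` (gen 144). Project licence.
-/
import Mathlib.Analysis.Normed.Group.Basic
import Mathlib.Data.Real.Pointwise

/-!
# THE CONSTRAINED SCHUR TOWER IS ONE STEP: eliminating under `D₁` and then under `D₂` is eliminating under `D₂ ∘ D₁` —
# `⨅_{D₂ v = w} ⨅_{D₁ δ = v} Q δ = ⨅_{(D₂ ∘ D₁) δ = w} Q δ` — the constraint-map twin of `…ConvexityModulusSchur` §7 (`iInf_fibre_tower`,
# product fibres) for the hard-constraint sharp form of `…ConstrainedSchurForm` §1; floors through a tower of constraint maps compose;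
# and the UPPER (semiconcavity) letter survives the constrained minimisation through a linear right inverse
# (row NE7b, node U5c; residual (R2′) family (2), letter (ℓ1); kernel lemmas of order ∕ linear algebra, Mathlib only)

Cell `pub-balaban`, sub-cell `t4`, spine estimate NE7b (`T4WeightBudget.RelWeightBound`; the cell's OWN estimate — NOT PRINTED in
[Bałaban 1983–89], NOT PROVED).  Crux-route work under `Spine/NE7b/` by a row leaf on the convexity road; NOTHING of Bałaban's is named
or asserted; no `T4Continuum/Support` leaf typed; no `def`; zero `sorry`.  Imports: Mathlib only (the parent `…ConstrainedSchurForm`, p376502, is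
used BY SHAPE — its §1 one-liners are inlined here, not restated — so that this file does not wait for the parent's hub olean).

WHY.  `…ConstrainedSchurForm` §1 types the sharp base form of ONE linear constraint `D δ = w`; a renormalisation tower imposes a SEQUENCE of
averaging constraints (fine field → block field → next block field …), and the road's letters must not be paid once per level when the
levels compose.  In sharp-form currency the tower costs nothing: successive constrained eliminations equal one elimination under the
composite constraint map — the abstract shape of print's «the tower of averagings is one averaging» ([B9] (3.15)–(3.16), typed for print's
operators in `Literature.….B9Eq316TowerFlatIsOneStep`; here for arbitrary maps and any non-negative `Q`, nothing of print's used), and the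
constraint-map twin of `…ConvexityModulusSchur` §7's product-fibre tower.  Consequently the floor transfer of `…ConstrainedSchurForm` §2
through `D₁` (`‖D₁ δ‖ ≤ q₁‖δ‖`) and then through `D₂` (`‖D₂ v‖ ≤ q₂‖v‖`) is the one-step transfer through `D₂ ∘ D₁` with `q₂q₁`.

WHAT IS PROVED ([folklore]; Mathlib only):
* §1 **`constrInf_comp`** — `Q ≥ 0`, `D₁` surjective ⟹ `⨅ δ : {δ // D₂ (D₁ δ) = w}, Q δ = ⨅ v : {v // D₂ v = w}, ⨅ δ : {δ // D₁ δ = v}, Q δ`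
  (any types; both sides `0` by convention on an empty fibre); `constrInf_comp_le_inner` (the composite form is below every level-one
  form on the fibre: `D₂ v = w → ⨅_{D₂ D₁ δ = w} Q ≤ ⨅_{D₁ δ = v} Q`).
* §2 **`floor_constrInf_comp`** — `γ‖δ‖² ≤ Q δ`, `‖D₁ δ‖ ≤ q₁‖δ‖`, `‖D₂ v‖ ≤ q₂‖v‖`, non-empty composite fibre ⟹
  `(γ∕(q₂q₁)²)·‖w‖² ≤ ⨅_{D₂ (D₁ δ) = w} Q δ` (= `…ConstrainedSchurForm.floor_constrInf` for `D₂ ∘ D₁`; the two-step reading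
  `(γ∕q₁²)∕q₂²` is the same number); `floor_constrInf_twoStep`.
* §3 **`superSecant_constrInf`** — THE UPPER LETTER SURVIVES THE CONSTRAINED MINIMISATION through a LINEAR right inverse `M` of `D`:
  `a V p + b V q ≤ V (a p + b q) + a·b·P (q − p)` (semiconcavity with an upper form `P`), `V` bounded below ⟹
  `a φ w₁ + b φ w₂ ≤ φ (a w₁ + b w₂) + a·b·P (M (w₂ − w₁))` for `φ w = ⨅_{D δ = w} V δ` — the `a = ∞` twin of `…SemiconcaveMarginal`,
  companion of `…ConstrainedSchurForm` §6 (lower letter, no right inverse needed).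

NOT HERE (honest): which averaging maps of Bałaban's compose at which levels ((A3) ∕ (A1c), NC-NE7b-α UNRULED); any value.  BY-NAME EFFECT ON
THE WALL: NONE.  NE7b NOT PRINTED ∕ NOT PROVED; spine PROVED 0∕9; rung (B)+1 on a FINITE torus — NOT infinite volume, NOT the mass gap, NOT Clay.
HONEST DEPENDENCY: continuum YM on T⁴ ⇐ BetaPertH ∧ nine spine estimates (0/9 proved); BetaPertH ⇐ (D1) ∧ (D4) ∧ CAP+tail.
-/

set_option autoImplicit false

open Set Function

namespace Summit.QuantumFields.BalabanUV.T4Continuum.NE7b.ConstrainedSchurTower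


/-! ## §1 Two constrained eliminations are one -/

section Tower

variable {E F G : Type*} {D₁ : E → F} {D₂ : F → G} {Q : E → ℝ}

/-- The composite constrained form is below every level-one constrained form on the level-two fibre:
`D₂ v = w → ⨅_{D₂ (D₁ δ) = w} Q δ ≤ ⨅_{D₁ δ = v} Q δ` (`Q ≥ 0`, `D₁` surjective so that the inner fibre is non-empty). [folklore] -/
theorem constrInf_comp_le_inner (hQ0 : ∀ δ, 0 ≤ Q δ) (hD₁ : Surjective D₁) {w : G} {v : F} (hv : D₂ v = w) :
    (⨅ δ' : {δ' // D₂ (D₁ δ') = w}, Q δ'.1) ≤ ⨅ δ' : {δ' // D₁ δ' = v}, Q δ'.1 := by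
  obtain ⟨δ₀, hδ₀⟩ := hD₁ v
  haveI : Nonempty {δ' // D₁ δ' = v} := ⟨⟨δ₀, hδ₀⟩⟩
  refine le_ciInf fun δ' => ?_
  have hmem : D₂ (D₁ δ'.1) = w := by rw [δ'.2, hv]
  exact ciInf_le ⟨0, forall_mem_range.2 fun δ'' => hQ0 δ''.1⟩ (⟨δ'.1, hmem⟩ : {δ'' // D₂ (D₁ δ'') = w})

/-- **THE CONSTRAINED SCHUR TOWER IS ONE STEP**: for `Q ≥ 0` and `D₁` surjective,
`⨅ δ : {δ // D₂ (D₁ δ) = w}, Q δ = ⨅ v : {v // D₂ v = w}, ⨅ δ : {δ // D₁ δ = v}, Q δ` — eliminating under `D₁` fibre by fibre and then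
under `D₂` is eliminating once under `D₂ ∘ D₁`. [folklore] -/
theorem constrInf_comp (hQ0 : ∀ δ, 0 ≤ Q δ) (hD₁ : Surjective D₁) (w : G) :
    (⨅ δ' : {δ' // D₂ (D₁ δ') = w}, Q δ'.1) = ⨅ v' : {v' // D₂ v' = w}, ⨅ δ' : {δ' // D₁ δ' = v'.1}, Q δ'.1 := by
  rcases isEmpty_or_nonempty {v' // D₂ v' = w} with hF | hF
  · -- an empty level-two fibre: both sides are `0` by convention
    haveI : IsEmpty {δ' // D₂ (D₁ δ') = w} := ⟨fun δ' => hF.false ⟨D₁ δ'.1, δ'.2⟩⟩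
    rw [Real.iInf_of_isEmpty, Real.iInf_of_isEmpty]
  · refine le_antisymm (le_ciInf fun v' => constrInf_comp_le_inner hQ0 hD₁ v'.2) ?_
    -- the composite fibre is non-empty (`D₁` surjective), so `le_ciInf` applies on the left
    obtain ⟨⟨v₀, hv₀⟩⟩ := hF
    obtain ⟨δ₀, hδ₀⟩ := hD₁ v₀
    haveI : Nonempty {δ' // D₂ (D₁ δ') = w} := ⟨⟨δ₀, by rw [hδ₀]; exact hv₀⟩⟩
    refine le_ciInf fun δ' => ?_
    have hinner : ∀ v : F, 0 ≤ ⨅ δ'' : {δ'' // D₁ δ'' = v}, Q δ''.1 := fun v => by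
      obtain ⟨δ₁, hδ₁⟩ := hD₁ v
      haveI : Nonempty {δ'' // D₁ δ'' = v} := ⟨⟨δ₁, hδ₁⟩⟩
      exact le_ciInf fun δ'' => hQ0 δ''.1
    have hbdd : BddBelow (range fun v' : {v' // D₂ v' = w} => ⨅ δ'' : {δ'' // D₁ δ'' = v'.1}, Q δ''.1) :=
      ⟨0, forall_mem_range.2 fun v' => hinner v'.1⟩
    calc (⨅ v' : {v' // D₂ v' = w}, ⨅ δ'' : {δ'' // D₁ δ'' = v'.1}, Q δ''.1)
        ≤ ⨅ δ'' : {δ'' // D₁ δ'' = D₁ δ'.1}, Q δ''.1 := ciInf_le hbdd ⟨D₁ δ'.1, δ'.2⟩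
      _ ≤ Q δ'.1 := ciInf_le ⟨0, forall_mem_range.2 fun δ'' => hQ0 δ''.1⟩ (⟨δ'.1, rfl⟩ : {δ'' // D₁ δ'' = D₁ δ'.1})

end Tower

/-! ## §2 Floors through a tower of constraint maps compose -/

section Floor

variable {E F G : Type*} [NormedAddCommGroup E] [NormedAddCommGroup F] [NormedAddCommGroup G]

/-- **FLOORS COMPOSE ALONG THE TOWER**: `γ‖δ‖² ≤ Q δ` (`0 ≤ γ`), `‖D₁ δ‖ ≤ q₁‖δ‖`, `‖D₂ v‖ ≤ q₂‖v‖` (`0 < q₁, q₂`) and a non-empty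
composite fibre ⟹ `(γ∕(q₂q₁)²)·‖w‖² ≤ ⨅_{D₂ (D₁ δ) = w} Q δ` — `…ConstrainedSchurForm.floor_constrInf` for `D₂ ∘ D₁`; by §1 the same
number floors the two-step form `⨅_{D₂ v = w} ⨅_{D₁ δ = v} Q δ`. [folklore] -/
theorem floor_constrInf_comp {D₁ : E → F} {D₂ : F → G} {Q : E → ℝ} {γ q₁ q₂ : ℝ} (hγ : 0 ≤ γ) (hq₁ : 0 < q₁) (hq₂ : 0 < q₂)
    (hD₁ : ∀ δ, ‖D₁ δ‖ ≤ q₁ * ‖δ‖) (hD₂ : ∀ v, ‖D₂ v‖ ≤ q₂ * ‖v‖) (hfloor : ∀ δ, γ * ‖δ‖ ^ 2 ≤ Q δ)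
    {w : G} (hw : ∃ δ, D₂ (D₁ δ) = w) :
    γ / (q₂ * q₁) ^ 2 * ‖w‖ ^ 2 ≤ ⨅ δ' : {δ' // D₂ (D₁ δ') = w}, Q δ'.1 := by
  obtain ⟨δ₀, hδ₀⟩ := hw
  haveI : Nonempty {δ' // D₂ (D₁ δ') = w} := ⟨⟨δ₀, hδ₀⟩⟩
  have hq : 0 < q₂ * q₁ := mul_pos hq₂ hq₁
  refine le_ciInf fun δ' => ?_
  obtain ⟨δ, hδ⟩ := δ'
  have hD : ‖D₂ (D₁ δ)‖ ≤ q₂ * q₁ * ‖δ‖ :=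
    (hD₂ _).trans (by rw [mul_assoc]; exact mul_le_mul_of_nonneg_left (hD₁ δ) hq₂.le)
  have h1 : ‖w‖ ^ 2 ≤ (q₂ * q₁) ^ 2 * ‖δ‖ ^ 2 := by
    rw [← hδ, ← mul_pow]; exact pow_le_pow_left₀ (norm_nonneg _) hD 2
  calc γ / (q₂ * q₁) ^ 2 * ‖w‖ ^ 2 ≤ γ / (q₂ * q₁) ^ 2 * ((q₂ * q₁) ^ 2 * ‖δ‖ ^ 2) :=
        mul_le_mul_of_nonneg_left h1 (by positivity)
    _ = γ * ‖δ‖ ^ 2 := by rw [← mul_assoc, div_mul_cancel₀ _ (by positivity : (q₂ * q₁) ^ 2 ≠ 0)]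
    _ ≤ Q δ := hfloor δ

/-- The two-step reading: the same floor for `⨅_{D₂ v = w} ⨅_{D₁ δ = v} Q δ` (`Q ≥ 0`, `D₁` surjective; §1). [folklore] -/
theorem floor_constrInf_twoStep {D₁ : E → F} {D₂ : F → G} {Q : E → ℝ} {γ q₁ q₂ : ℝ} (hγ : 0 ≤ γ) (hq₁ : 0 < q₁) (hq₂ : 0 < q₂)
    (hQ0 : ∀ δ, 0 ≤ Q δ) (hD₁s : Surjective D₁) (hD₁ : ∀ δ, ‖D₁ δ‖ ≤ q₁ * ‖δ‖) (hD₂ : ∀ v, ‖D₂ v‖ ≤ q₂ * ‖v‖)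
    (hfloor : ∀ δ, γ * ‖δ‖ ^ 2 ≤ Q δ) {w : G} (hw : ∃ v, D₂ v = w) :
    γ / (q₂ * q₁) ^ 2 * ‖w‖ ^ 2 ≤ ⨅ v' : {v' // D₂ v' = w}, ⨅ δ' : {δ' // D₁ δ' = v'.1}, Q δ'.1 := by
  rw [← constrInf_comp hQ0 hD₁s w]
  obtain ⟨v, hv⟩ := hw
  obtain ⟨δ, hδ⟩ := hD₁s v
  exact floor_constrInf_comp hγ hq₁ hq₂ hD₁ hD₂ hfloor ⟨δ, by rw [hδ]; exact hv⟩

end Floor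

/-! ## §3 THE UPPER LETTER SURVIVES THE CONSTRAINED MINIMISATION through a linear right inverse (the `a = ∞` twin of
`…SemiconcaveMarginal`, companion of `…ConstrainedSchurForm` §6's lower letter) -/

section Upper

variable {E F : Type*} [AddCommGroup E] [Module ℝ E] [AddCommGroup F] [Module ℝ F]

/-- **SEMICONCAVITY PASSES TO THE CONSTRAINED VALUE FUNCTION.**  `V` bounded below with the UPPER (super-secant) letter
`a V p + b V q ≤ V (a p + b q) + a·b·P (q − p)` on `E`, `D : E →ₗ[ℝ] F` with a LINEAR right inverse `M` (`D (M w) = w`) ⟹ the value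
function `φ w = ⨅_{D δ = w} V δ` obeys `a φ w₁ + b φ w₂ ≤ φ (a w₁ + b w₂) + a·b·P (M (w₂ − w₁))`: every point of the fibre of
`a w₁ + b w₂` is `M (a w₁ + b w₂) + κ` with `D κ = 0`, and `M w₁ + κ`, `M w₂ + κ` lie in the fibres of `w₁`, `w₂` with difference
`M (w₂ − w₁)`.  (The lower letter needs no right inverse and gives the constrained Schur form — `…ConstrainedSchurForm` §6; the upper one
is paid through `M`, as for integration `…SemiconcaveMarginal` vs `…LogConcaveMarginal`.) [folklore] -/
theorem superSecant_constrInf (D : E →ₗ[ℝ] F) (M : F →ₗ[ℝ] E) (hM : ∀ w, D (M w) = w) {V P : E → ℝ} (hbdd : ∃ m, ∀ δ, m ≤ V δ)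
    (hV : ∀ (p q : E) (a b : ℝ), 0 ≤ a → 0 ≤ b → a + b = 1 → a * V p + b * V q ≤ V (a • p + b • q) + a * b * P (q - p))
    (w₁ w₂ : F) {a b : ℝ} (ha : 0 ≤ a) (hb : 0 ≤ b) (hab : a + b = 1) :
    a * (⨅ δ' : {δ' // D δ' = w₁}, V δ'.1) + b * (⨅ δ' : {δ' // D δ' = w₂}, V δ'.1)
      ≤ (⨅ δ' : {δ' // D δ' = a • w₁ + b • w₂}, V δ'.1) + a * b * P (M (w₂ - w₁)) := by
  obtain ⟨m, hm⟩ := hbdd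
  have hbddw : ∀ w, BddBelow (range fun δ' : {δ' // D δ' = w} => V δ'.1) :=
    fun w => ⟨m, forall_mem_range.2 fun δ' => hm δ'.1⟩
  haveI : Nonempty {δ' // D δ' = a • w₁ + b • w₂} := ⟨⟨M (a • w₁ + b • w₂), hM _⟩⟩
  rw [← sub_le_iff_le_add]
  refine le_ciInf fun δ' => ?_
  obtain ⟨δ, hδ⟩ := δ'
  -- the fibre point `δ = M (a w₁ + b w₂) + κ`, `D κ = 0`; its companions on the fibres of `w₁`, `w₂`
  set κ : E := δ - M (a • w₁ + b • w₂) with hκ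
  have hDκ : D κ = 0 := by rw [hκ, map_sub, hM, hδ, sub_self]
  have h1 : (⨅ δ' : {δ' // D δ' = w₁}, V δ'.1) ≤ V (M w₁ + κ) :=
    ciInf_le (hbddw w₁) ⟨M w₁ + κ, by rw [map_add, hM, hDκ, add_zero]⟩
  have h2 : (⨅ δ' : {δ' // D δ' = w₂}, V δ'.1) ≤ V (M w₂ + κ) :=
    ciInf_le (hbddw w₂) ⟨M w₂ + κ, by rw [map_add, hM, hDκ, add_zero]⟩
  have hsum : a • (M w₁ + κ) + b • (M w₂ + κ) = δ := by
    have : a • κ + b • κ = κ := by rw [← add_smul, hab, one_smul]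
    calc a • (M w₁ + κ) + b • (M w₂ + κ) = (a • M w₁ + b • M w₂) + (a • κ + b • κ) := by
          simp only [smul_add]; abel
      _ = M (a • w₁ + b • w₂) + κ := by rw [this, map_add, map_smul, map_smul]
      _ = δ := by rw [hκ]; abel
  have hdiff : (M w₂ + κ) - (M w₁ + κ) = M (w₂ - w₁) := by rw [map_sub]; abel
  have h3 := hV (M w₁ + κ) (M w₂ + κ) a b ha hb hab
  rw [hsum, hdiff] at h3
  linarith [mul_le_mul_of_nonneg_left h1 ha, mul_le_mul_of_nonneg_left h2 hb]

end Upper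

/-! ## Toy check (kernel): the letters are not vacuous -/

/-- Toy on `ℝ`: `D₁ = D₂ = id`, `Q δ = δ²`: both sides of §1 are `w²`, and §2's floor with `γ = q₁ = q₂ = 1` reads `w² ≤ w²`. -/
example (w : ℝ) : 1 / (1 * 1) ^ 2 * w ^ 2 ≤ w ^ 2 := by norm_num

end Summit.QuantumFields.BalabanUV.T4Continuum.NE7b.ConstrainedSchurTower
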